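import Summits.ResolutionOfSingularities.ResolutionOfSingularities.Theorems.DeltaCutSingCertificates
import Mathlib.Logic.Hydra
import HarnessLib

/-!
# DeltaCutNerve — lens-6 g31 node «NerveCut», part 1/3: THE NERVE GAME (Theorem A)

Kernel, hypothesis-free, combinatorial.  New object `Nerve.State` = (faces `K : Finset (Finset ℕ)` of the dual complex of
the boundary on the weak-contact hypersurface `H`, labels `a : ℕ → ℕ`); a face is PERMISSIBLE at marking `n` iff its weight
`Σ a ≥ n`; a MOVE = stellar subdivision at a permissible face with a fresh vertex of label `a(F₀) − n` (= blowing up the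
stratum); `Nerve.IsMinMove`: the face blown up has MINIMAL CARDINALITY among the permissible faces (Encinas–Villamayor's `Γ`,
least codimension first, any tie-break).  **`Nerve.isMinMove_wf` / `Nerve.no_infinite_minPlay`**: on downward-closed
complexes every minimal-face play is FINITE — potential `(D − min|F|, multiset of weights of the minimal-size permissible
faces)` in `ℕ ×ₗₑₓ (Multiset ℕ, Relation.CutExpand (<))` (Dershowitz–Manna, `Mathlib.Logic.Hydra`).  `D0nerve_isMinMove`:
the game is inhabited at D₀ = `(x², z⁶w⁶)` and its first centre is a vertex, not the edge.  The node summary (finding,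
census reading, barrier / complement) is the module docstring of part 3/3 `DeltaCutNerveCertificates`.  0 sorry.
-/

noncomputable section

open CategoryTheory CategoryTheory.Limits AlgebraicGeometry TopologicalSpace IsLocalRing
open Literature.AlgebraicGeometry.Resolution

namespace Summit.ResolutionOfSingularities.ResolutionOfSingularities.Theorems.DeltaCutClasses

/-! ## §A THE NERVE GAME: cardinality-minimal permissible-face plays TERMINATE (Encinas–Villamayor Γ, dual-complex form) -/

section NerveGame

namespace Nerve

/-- **A STATE OF THE NERVE GAME**: `K` = the faces of the dual complex of the boundary (finite family of finite vertex sets,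
meant downward closed: `Down`), `a` = the labels (orders of the marked monomial ideal along the boundary components; values at
non-vertices irrelevant).  DEFINITION (new object of this node). -/
structure State where
  /-- the faces -/
  K : Finset (Finset ℕ)
  /-- the labels -/
  a : ℕ → ℕ

namespace State

/-- the weight of a face: the order of the monomial along the stratum `⋂_{i ∈ F} D_i`. DEFINITION (support). -/
def weight (s : State) (F : Finset ℕ) : ℕ := ∑ i ∈ F, s.a i

/-- a PERMISSIBLE face at marking `n`: a face of weight `≥ n` (its stratum lies in the order-`n` locus). DEFINITION (support). -/
def Perm (n : ℕ) (s : State) (F : Finset ℕ) : Prop := F ∈ s.K ∧ n ≤ s.weight F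

/-- Permissibility of a face is decidable (finite data). NerveCut (lens-6 g31); docstring added by the writer (lint.docstring). -/
instance (n : ℕ) (s : State) : DecidablePred (s.Perm n) := fun F =>
  inferInstanceAs (Decidable (F ∈ s.K ∧ n ≤ s.weight F))

/-- the faces are downward closed (a simplicial complex). DEFINITION (support). -/
def Down (s : State) : Prop := ∀ ⦃F⦄, F ∈ s.K → ∀ ⦃G⦄, G ⊆ F → G ∈ s.K

/-- `v` is a fresh vertex (the name of the exceptional component to be born). DEFINITION (support). -/
def Fresh (s : State) (v : ℕ) : Prop := ∀ ⦃F⦄, F ∈ s.K → v ∉ F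

/-- every face has at most `D` vertices (`D` = dimension bound: at most `dim` components through a point). DEFINITION
(support). -/
def Bdd (s : State) (D : ℕ) : Prop := ∀ ⦃F⦄, F ∈ s.K → F.card ≤ D

end State

/-- **STELLAR SUBDIVISION** of the complex `K` at the face `F₀` with new vertex `v` = the dual complex after blowing up the
stratum of `F₀`: the faces not containing `F₀` survive, and `v` is joined to every face `G` spanning a face together with `F₀`
but not containing it. DEFINITION (support). -/
def stellar (K : Finset (Finset ℕ)) (F₀ : Finset ℕ) (v : ℕ) : Finset (Finset ℕ) :=
  K.filter (fun G => ¬ F₀ ⊆ G) ∪ (K.filter (fun G => G ∪ F₀ ∈ K ∧ ¬ F₀ ⊆ G)).image (insert v)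

/-- `mem_stellar`: NerveCut (lens-6 g31) helper; docstring added by the writer (lint.docstring) [folklore] -/
theorem mem_stellar {K : Finset (Finset ℕ)} {F₀ : Finset ℕ} {v : ℕ} {H : Finset ℕ} :
    H ∈ stellar K F₀ v ↔ (H ∈ K ∧ ¬ F₀ ⊆ H) ∨ ∃ G, (G ∈ K ∧ G ∪ F₀ ∈ K ∧ ¬ F₀ ⊆ G) ∧ insert v G = H := by
  simp only [stellar, Finset.mem_union, Finset.mem_filter, Finset.mem_image]

/-- **THE MOVE** = blow up the stratum of the permissible face `F₀`: stellar subdivision, the new component `v` gets the label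
`a(F₀) − n` (order of the controlled transform along the exceptional divisor), old labels unchanged. DEFINITION (support). -/
def State.move (n : ℕ) (s : State) (F₀ : Finset ℕ) (v : ℕ) : State :=
  ⟨stellar s.K F₀ v, Function.update s.a v (s.weight F₀ - n)⟩

/-- **A MOVE OF THE MINIMAL-FACE LAW** (Encinas–Villamayor's `Γ`: minimal codimension first, ANY tie-break): `t` arises from
`s` by blowing up a permissible face `F₀` of MINIMAL CARDINALITY among the permissible faces, with a fresh vertex.
DEFINITION (the law under test). -/
def IsMinMove (n : ℕ) (s t : State) : Prop :=
  ∃ F₀ v, s.Perm n F₀ ∧ (∀ F, s.Perm n F → F₀.card ≤ F.card) ∧ s.Fresh v ∧ t = s.move n F₀ v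

variable {n : ℕ}

/-- `move_K`: NerveCut (lens-6 g31) helper; docstring added by the writer (lint.docstring) [folklore] -/
theorem move_K (s : State) (F₀ : Finset ℕ) (v : ℕ) : (s.move n F₀ v).K = stellar s.K F₀ v := rfl

/-- `weight_move_of_notMem`: NerveCut (lens-6 g31) helper; docstring added by the writer (lint.docstring) [folklore] -/
theorem weight_move_of_notMem {s : State} {F₀ H : Finset ℕ} {v : ℕ} (hv : v ∉ H) :
    (s.move n F₀ v).weight H = s.weight H := by
  unfold State.weight State.move
  exact Finset.sum_congr rfl fun i hi => Function.update_of_ne (ne_of_mem_of_not_mem hi hv) _ _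

/-- `weight_move_insert`: NerveCut (lens-6 g31) helper; docstring added by the writer (lint.docstring) [folklore] -/
theorem weight_move_insert {s : State} {F₀ G : Finset ℕ} {v : ℕ} (hv : v ∉ G) :
    (s.move n F₀ v).weight (insert v G) = (s.weight F₀ - n) + s.weight G := by
  have h1 : (s.move n F₀ v).weight (insert v G) = (s.move n F₀ v).a v + (s.move n F₀ v).weight G := by
    unfold State.weight; exact Finset.sum_insert hv
  have h2 : (s.move n F₀ v).a v = s.weight F₀ - n :=
    show Function.update s.a v (s.weight F₀ - n) v = _ from Function.update_self ..
  rw [h1, weight_move_of_notMem hv, h2]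

/-- `weight_insert`: NerveCut (lens-6 g31) helper; docstring added by the writer (lint.docstring) [folklore] -/
theorem weight_insert {s : State} {G : Finset ℕ} {i : ℕ} (hi : i ∉ G) :
    s.weight (insert i G) = s.a i + s.weight G := by
  unfold State.weight; exact Finset.sum_insert hi

/-- `weight_eq_add_erase`: NerveCut (lens-6 g31) helper; docstring added by the writer (lint.docstring) [folklore] -/
theorem weight_eq_add_erase {s : State} {F : Finset ℕ} {i : ℕ} (hi : i ∈ F) :
    s.weight F = s.a i + s.weight (F.erase i) := by
  unfold State.weight; exact (Finset.add_sum_erase F s.a hi).symm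

/-- downward closure survives the move. [new; elementary] -/
theorem Down.move {s : State} (hD : s.Down) (F₀ : Finset ℕ) (v : ℕ) : (s.move n F₀ v).Down := by
  intro H hH G hGH
  rw [move_K, mem_stellar] at hH ⊢
  rcases hH with ⟨hHK, hF₀H⟩ | ⟨G', ⟨hG'K, hG'F₀, hF₀G'⟩, rfl⟩
  · exact Or.inl ⟨hD hHK hGH, fun h => hF₀H (h.trans hGH)⟩
  · by_cases hvG : v ∈ G
    · have h1 : G.erase v ⊆ G' := Finset.subset_insert_iff.1 hGH
      refine Or.inr ⟨G.erase v, ⟨hD hG'K h1, hD hG'F₀ (Finset.union_subset_union h1 le_rfl), fun h => hF₀G' (h.trans h1)⟩,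
        Finset.insert_erase hvG⟩
    · have h1 : G ⊆ G' := (Finset.subset_insert_iff_of_notMem hvG).1 hGH
      exact Or.inl ⟨hD hG'K h1, fun h => hF₀G' (h.trans h1)⟩

/-- the face-size bound survives the move. [new; elementary] -/
theorem Bdd.move {s : State} {D : ℕ} (hB : s.Bdd D) (F₀ : Finset ℕ) (v : ℕ) : (s.move n F₀ v).Bdd D := by
  intro H hH
  rw [move_K, mem_stellar] at hH
  rcases hH with ⟨hHK, -⟩ | ⟨G', ⟨-, hG'F₀, hF₀G'⟩, rfl⟩
  · exact hB hHK
  · have hss : G' ⊂ G' ∪ F₀ :=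
      Finset.ssubset_iff_subset_ne.2 ⟨Finset.subset_union_left, fun h => hF₀G' (h ▸ Finset.subset_union_right)⟩
    have h1 := Finset.card_lt_card hss
    have h2 := hB hG'F₀
    exact (Finset.card_insert_le v G').trans (by omega)

/-- old faces of the subdivided complex avoiding the fresh vertex are old faces not containing `F₀`. [new; elementary] -/
theorem mem_move_of_notMem {s : State} {F₀ H : Finset ℕ} {v : ℕ} (hv : v ∉ H) :
    H ∈ (s.move n F₀ v).K ↔ H ∈ s.K ∧ ¬ F₀ ⊆ H := by
  rw [move_K, mem_stellar]
  constructor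
  · rintro (h | ⟨G, -, rfl⟩)
    · exact h
    · exact (hv (Finset.mem_insert_self v G)).elim
  · exact Or.inl

/-- **KEY LEMMA 1 — NO SMALLER PERMISSIBLE FACE IS BORN**: after a minimal-face move at `F₀`, every permissible face has at
least `|F₀|` vertices (a new face `G ∪ {v}` with `|G| + 1 < |F₀|` weighs `a(F₀) − n + a(G) < n`, because `G ∪ {i}` and
`F₀ ∖ {i}` are impermissible for any `i ∈ F₀ ∖ G`). [new] -/
theorem card_le_of_perm_move {s : State} (hD : s.Down) {F₀ : Finset ℕ} {v : ℕ} (hF₀ : s.Perm n F₀)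
    (hmin : ∀ F, s.Perm n F → F₀.card ≤ F.card) (hv : s.Fresh v) {H : Finset ℕ} (hH : (s.move n F₀ v).Perm n H) :
    F₀.card ≤ H.card := by
  obtain ⟨hHK, hHw⟩ := hH
  rw [move_K, mem_stellar] at hHK
  rcases hHK with ⟨hHK, hF₀H⟩ | ⟨G, ⟨hGK, hGF₀, hF₀G⟩, rfl⟩
  · rw [weight_move_of_notMem (hv hHK)] at hHw
    exact hmin H ⟨hHK, hHw⟩
  · have hvG : v ∉ G := hv hGK
    rw [weight_move_insert hvG] at hHw
    by_contra hlt
    rw [Finset.card_insert_of_notMem hvG, not_le] at hlt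
    obtain ⟨i, hiF₀, hiG⟩ := Finset.not_subset.1 hF₀G
    have h1 : insert i G ∈ s.K :=
      hD hGF₀ (Finset.insert_subset_iff.2 ⟨Finset.mem_union_right _ hiF₀, Finset.subset_union_left⟩)
    have h2 : ¬ n ≤ s.weight (insert i G) := fun h => by
      have := hmin _ ⟨h1, h⟩; rw [Finset.card_insert_of_notMem hiG] at this; omega
    have h3 : F₀.erase i ∈ s.K := hD hF₀.1 (Finset.erase_subset i F₀)
    have h4 : ¬ n ≤ s.weight (F₀.erase i) := fun h => by
      have := hmin _ ⟨h3, h⟩; rw [Finset.card_erase_of_mem hiF₀] at this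
      have := Finset.card_pos.2 ⟨i, hiF₀⟩; omega
    rw [weight_insert hiG] at h2
    have h5 := weight_eq_add_erase (s := s) hiF₀
    have h6 := hF₀.2
    omega

/-- **KEY LEMMA 2 — NEW PERMISSIBLE FACES OF THE MINIMAL SIZE WEIGH LESS THAN `a(F₀)`** (`G` has fewer than `|F₀|` vertices,
hence is impermissible: `a(G) < n`). [new] -/
theorem weight_lt_of_perm_move {s : State} {F₀ : Finset ℕ} {v : ℕ} (hF₀ : s.Perm n F₀)
    (hmin : ∀ F, s.Perm n F → F₀.card ≤ F.card) (hv : s.Fresh v) {H : Finset ℕ} (hH : (s.move n F₀ v).Perm n H)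
    (hcard : H.card = F₀.card) (hvH : v ∈ H) : (s.move n F₀ v).weight H < s.weight F₀ := by
  obtain ⟨hHK, -⟩ := hH
  rw [move_K, mem_stellar] at hHK
  rcases hHK with ⟨hHK, -⟩ | ⟨G, ⟨hGK, -, -⟩, rfl⟩
  · exact (hv hHK hvH).elim
  · have hvG : v ∉ G := hv hGK
    rw [weight_move_insert hvG]
    rw [Finset.card_insert_of_notMem hvG] at hcard
    have h2 : ¬ n ≤ s.weight G := fun h => by have := hmin _ ⟨hGK, h⟩; omega
    have h6 := hF₀.2
    omega

/-- old faces of the minimal size other than `F₀` keep their membership and permissibility. [new; elementary] -/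
theorem perm_move_iff_of_notMem {s : State} {F₀ H : Finset ℕ} {v : ℕ} (hv : v ∉ H) (hcard : H.card = F₀.card) :
    (s.move n F₀ v).Perm n H ↔ s.Perm n H ∧ H ≠ F₀ := by
  unfold State.Perm
  rw [mem_move_of_notMem hv, weight_move_of_notMem hv]
  constructor
  · rintro ⟨⟨hK, hF⟩, hw⟩
    exact ⟨⟨hK, hw⟩, fun h => hF (h ▸ le_rfl)⟩
  · rintro ⟨⟨hK, hw⟩, hne⟩
    exact ⟨⟨hK, fun h => hne (Finset.eq_of_subset_of_card_le h (hcard ▸ le_rfl)).symm⟩, hw⟩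

/-! ### The potential: (bound − minimal permissible size, multiset of the weights of the minimal-size permissible faces) -/

/-- the minimal cardinality of a permissible face (`0` if there is none). DEFINITION (support). -/
def minCard (n : ℕ) (s : State) : ℕ := sInf ((fun F : Finset ℕ => F.card) '' {F | s.Perm n F})

/-- the multiset of weights of the permissible faces with exactly `c` vertices. DEFINITION (support). -/
def level (n : ℕ) (s : State) (c : ℕ) : Multiset ℕ :=
  ((s.K.filter fun F => s.Perm n F ∧ F.card = c).val).map s.weight

/-- the potential. DEFINITION (support). -/
def pot (n D : ℕ) (s : State) : ℕ × Multiset ℕ := (D - minCard n s, level n s (minCard n s))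

/-- `minCard_le`: NerveCut (lens-6 g31) helper; docstring added by the writer (lint.docstring) [folklore] -/
theorem minCard_le {s : State} {F : Finset ℕ} (hF : s.Perm n F) : minCard n s ≤ F.card :=
  Nat.sInf_le ⟨F, hF, rfl⟩

/-- `exists_card_eq_minCard`: NerveCut (lens-6 g31) helper; docstring added by the writer (lint.docstring) [folklore] -/
theorem exists_card_eq_minCard {s : State} (h : ∃ F, s.Perm n F) : ∃ F, s.Perm n F ∧ F.card = minCard n s := by
  obtain ⟨F, hF⟩ := h
  have hne : ((fun F : Finset ℕ => F.card) '' {F | s.Perm n F}).Nonempty := ⟨F.card, F, hF, rfl⟩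
  obtain ⟨F₁, hF₁, h⟩ := Nat.sInf_mem hne
  exact ⟨F₁, hF₁, h⟩

/-- `card_eq_minCard_of_min`: NerveCut (lens-6 g31) helper; docstring added by the writer (lint.docstring) [folklore] -/
theorem card_eq_minCard_of_min {s : State} {F₀ : Finset ℕ} (hF₀ : s.Perm n F₀) (hmin : ∀ F, s.Perm n F → F₀.card ≤ F.card) :
    F₀.card = minCard n s := by
  obtain ⟨F₁, hF₁, h⟩ := exists_card_eq_minCard ⟨F₀, hF₀⟩
  exact le_antisymm (h ▸ hmin F₁ hF₁) (minCard_le hF₀)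

/-- **THE POTENTIAL DROPS AT EVERY MINIMAL-FACE MOVE** (while a permissible face remains): either the minimal permissible size
goes up, or it stays and the multiset of weights at that size goes down in the Dershowitz–Manna (hydra) order — `F₀` is
removed, the newcomers are lighter (key lemma 2), nothing smaller is born (key lemma 1). [new] -/
theorem pot_rel_of_isMinMove {s t : State} {D : ℕ} (hD : s.Down) (hB : s.Bdd D) (hm : IsMinMove n s t)
    (hex : ∃ H, t.Perm n H) :
    Prod.Lex (· < ·) (Relation.CutExpand (· < ·)) (pot n D t) (pot n D s) := by
  classical
  obtain ⟨F₀, v, hF₀, hmin, hv, rfl⟩ := hm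
  have hP : F₀.card = minCard n s := card_eq_minCard_of_min hF₀ hmin
  obtain ⟨H₁, hH₁, hH₁c⟩ := exists_card_eq_minCard hex
  have hle : F₀.card ≤ minCard n (s.move n F₀ v) := hH₁c ▸ card_le_of_perm_move hD hF₀ hmin hv hH₁
  have hBD : minCard n (s.move n F₀ v) ≤ D := hH₁c ▸ Bdd.move hB F₀ v hH₁.1
  unfold pot
  rcases hle.eq_or_lt with heq | hlt
  · -- same minimal size: hydra step on the level multiset
    rw [← heq, ← hP]
    apply Prod.Lex.right
    rw [Relation.cutExpand_iff]
    set A := (s.move n F₀ v).K.filter fun F => (s.move n F₀ v).Perm n F ∧ F.card = F₀.card with hA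
    refine ⟨(A.val.filter fun H => ¬ v ∉ H).map (s.move n F₀ v).weight, s.weight F₀, ?_, ?_, ?_⟩
    · intro a' ha'
      obtain ⟨H, hH, rfl⟩ := Multiset.mem_map.1 ha'
      rw [Multiset.mem_filter, not_not] at hH
      obtain ⟨hHA, hvH⟩ := hH
      rw [hA, Finset.mem_val, Finset.mem_filter] at hHA
      exact weight_lt_of_perm_move hF₀ hmin hv hHA.2.1 hHA.2.2 hvH
    · exact Multiset.mem_map_of_mem _ (by rw [Finset.mem_val, Finset.mem_filter]; exact ⟨hF₀.1, hF₀, rfl⟩)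
    · -- split the new level into OLD faces (= old level minus F₀) and NEW faces
      have hold : A.filter (fun H => v ∉ H) = (s.K.filter fun F => s.Perm n F ∧ F.card = F₀.card).erase F₀ := by
        ext H
        rw [Finset.mem_filter, hA, Finset.mem_filter, Finset.mem_erase, Finset.mem_filter]
        constructor
        · rintro ⟨⟨-, hP', hc⟩, hvH⟩
          obtain ⟨hsP, hne⟩ := (perm_move_iff_of_notMem hvH hc).1 hP'
          exact ⟨hne, hsP.1, hsP, hc⟩
        · rintro ⟨hne, hK, hsP, hc⟩
          have hvH : v ∉ H := hv hK
          have hP' := (perm_move_iff_of_notMem (s := s) (n := n) (F₀ := F₀) hvH hc).2 ⟨hsP, hne⟩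
          exact ⟨⟨hP'.1, hP', hc⟩, hvH⟩
      have hF₀mem : F₀ ∈ (s.K.filter fun F => s.Perm n F ∧ F.card = F₀.card).val := by
        rw [Finset.mem_val, Finset.mem_filter]; exact ⟨hF₀.1, hF₀, rfl⟩
      have hold' : (A.val.filter fun H => v ∉ H).map (s.move n F₀ v).weight
          = (((s.K.filter fun F => s.Perm n F ∧ F.card = F₀.card).val).map s.weight).erase (s.weight F₀) := by
        rw [← Finset.filter_val, hold, Finset.erase_val, ← Multiset.map_erase_of_mem _ _ hF₀mem]
        exact Multiset.map_congr rfl fun H hH =>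
          weight_move_of_notMem (hv (Finset.mem_filter.1 (Multiset.mem_of_mem_erase hH)).1)
      have hL : A.val.map (s.move n F₀ v).weight = (A.val.filter fun H => v ∉ H).map (s.move n F₀ v).weight
          + (A.val.filter fun H => ¬ v ∉ H).map (s.move n F₀ v).weight := by
        rw [← Multiset.map_add, Multiset.filter_add_not]
      unfold level
      rw [← hA, hL, hold']
  · -- the minimal size went up
    apply Prod.Lex.left
    omega

/-- the relevant well-founded order on potentials: lexicographic (ℕ, hydra order on multisets of ℕ). [Mathlib:
`WellFounded.prod_lex`, `WellFounded.cutExpand` (Dershowitz–Manna)] -/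
theorem pot_rel_wf : WellFounded (Prod.Lex (· < ·) (Relation.CutExpand (· < ·)) : ℕ × Multiset ℕ → ℕ × Multiset ℕ → Prop) :=
  wellFounded_lt.prod_lex wellFounded_lt.cutExpand

/-- **THEOREM A (NERVE TERMINATION) — THE MINIMAL-FACE LAW IS A WELL-FOUNDED GAME.**  On downward-closed complexes with faces
of at most `D` vertices, the move relation of the minimal-cardinality law (blow up a permissible face of least cardinality,
any tie-break, fresh exceptional vertex labelled `a(F₀) − n`) is well founded: EVERY play is finite.  This is the dual-complex
(nerve) form of the termination of Encinas–Villamayor's `Γ`-function in the monomial case, proved here by the potential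
`(D − min |F|, {a(F) : F permissible, |F| minimal})` in `ℕ ×ₗₑₓ (Multiset ℕ, hydra order)`.  [new — the COMPLEMENT of the
barrier certified in §§B–C: the crossing-first / deepest-stratum-first law diverges on the same data] -/
theorem isMinMove_wf (n D : ℕ) : WellFounded (fun t s : State => s.Down ∧ s.Bdd D ∧ IsMinMove n s t) := by
  have hφ := InvImage.wf (pot n D) (pot_rel_wf)
  refine ⟨fun s => ?_⟩
  induction hφ.apply s with
  | intro s _ ih =>
    refine Acc.intro s fun t ht => ?_
    obtain ⟨hD, hB, hm⟩ := ht
    by_cases hex : ∃ H, t.Perm n H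
    · exact ih t (pot_rel_of_isMinMove hD hB hm hex)
    · exact Acc.intro t fun u hu => by
        obtain ⟨-, -, F₀, v, hF₀, -⟩ := hu
        exact (hex ⟨F₀, hF₀⟩).elim

/-- **THEOREM A, sequence form — NO INFINITE MINIMAL-FACE PLAY** from a downward-closed state. [new] -/
theorem no_infinite_minPlay (n : ℕ) (seq : ℕ → State) (h0 : (seq 0).Down)
    (hmove : ∀ i, IsMinMove n (seq i) (seq (i + 1))) : False := by
  set D := (seq 0).K.sup Finset.card with hD
  have hB0 : (seq 0).Bdd D := fun F hF => Finset.le_sup hF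
  have hinv : ∀ i, (seq i).Down ∧ (seq i).Bdd D := by
    intro i
    induction i with
    | zero => exact ⟨h0, hB0⟩
    | succ i ih =>
      obtain ⟨F₀, v, -, -, -, he⟩ := hmove i
      rw [he]
      exact ⟨Down.move ih.1 F₀ v, Bdd.move ih.2 F₀ v⟩
  obtain ⟨x, ⟨i, rfl⟩, hmin⟩ := (isMinMove_wf n D).has_min (Set.range seq) ⟨seq 0, 0, rfl⟩
  exact hmin (seq (i + 1)) ⟨i + 1, rfl⟩ ⟨(hinv i).1, (hinv i).2, hmove i⟩

/-! ### The nerve of D₀ = (x², z⁶w⁶): two vertices `0 = P_z`, `1 = P_w` of label 6 joined by the edge `L` -/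

/-- the nerve state of D₀ on `H = {x = 0}`: complex = all faces of the edge `{0, 1}`, labels `a 0 = a 1 = 6`. -/
def D0nerve : State := ⟨({0, 1} : Finset ℕ).powerset, fun i => if i = 0 ∨ i = 1 then 6 else 0⟩

/-- `D0nerve_down`: NerveCut (lens-6 g31) helper; docstring added by the writer (lint.docstring) [folklore] -/
theorem D0nerve_down : D0nerve.Down := fun _ hF _ hGF =>
  Finset.mem_powerset.2 (hGF.trans (Finset.mem_powerset.1 hF))

/-- **THE MINIMAL-FACE LAW MOVES AT D₀, AND DIFFERENTLY FROM THE CROSSING-FIRST LAW**: its first centre is a VERTEX (an old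
plane `P_z`, cardinality 1, weight 6 ≥ 2), not the edge `L` (cardinality 2) that `sHop` / cn37's round blow up first — the
game of Theorem A is inhabited at D₀ and Theorem A applies to it (`D0nerve_down`). [new; elementary] -/
theorem D0nerve_isMinMove : ∃ t, IsMinMove 2 D0nerve t := by
  refine ⟨_, {0}, 2, ⟨Finset.mem_powerset.2 (by decide), ?_⟩, fun F hF => ?_, fun F hF h2 => ?_, rfl⟩
  · show 2 ≤ ∑ i ∈ ({0} : Finset ℕ), (if i = 0 ∨ i = 1 then 6 else 0)
    simp
  · rw [Finset.card_singleton, Nat.one_le_iff_ne_zero, Ne, Finset.card_eq_zero]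
    rintro rfl
    exact absurd hF.2 (by decide)
  · have := Finset.mem_powerset.1 hF h2
    exact absurd this (by decide)

end Nerve

end NerveGame

end Summit.ResolutionOfSingularities.ResolutionOfSingularities.Theorems.DeltaCutClasses
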